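import Summits.Schanuel.Schanuel.Theorems.ZilberEacBranchPoleFibreGrowth
import Summits.Schanuel.Schanuel.Theorems.ZilberEacGrowthExponent
import Summits.Schanuel.Schanuel.Theorems.ZilberEacPoleFibreAsymptotics
import HarnessLib

/-!
# Arbitrary base branches, LXXIV(b): pole / zero fibre values along a RAMIFIED place with equal
# pole orders and a real IRRATIONAL direction — dense with NO hypothesis on the Puiseux tail
# (subleading growth / THEOREM I dichotomy)

HONEST FRAMING.  Cell `pub-schanuel` (Zilber's Exponential-Algebraic Closedness, case ladder;
host summit Schanuel), seat 2, gen 32.  File LXXI proved density of a cylinder germ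
`(s^{-k}, Φ(s)s^{-k}, ψ(s)s^L, e^{x₁})` (`L ≠ 0`, `Φ(0) = a ∈ ℝ ∖ ℚ`) under `Φ − a = O(s^k)`
(no Puiseux terms between the leading one and the ramification order; automatic for `k = 1`).
This file removes that hypothesis.  Write `Φ(s)s^{-k} = a s^{-k} + Σ_{0<i<k} φ_{k−i} s^{-i} + R(s)`
(Taylor, `R` analytic).  Along the points of file XXXI on the sheet with tangent `z` (`z^k = 2πi`),
`s_n^{-1} = z e^{ℓ_n/k} u_n^{-1}` with `ℓ_n = log n` and `u_n^{-1} = 1 + O(log n/n)` (file LXXIV(a)),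
so `Re x₁ = a·Re x₀ + g_R(e^{ℓ_n/k}) + o(1) + O(1)` where `g_R(x) = Re Q(x)`,
`Q(X) = Σ_{0<i<k} φ_{k−i} z^i X^i` (the polynomial perturbation lemma moves `u_n^{-1}` out at the
cost `o(1)`, because `deg Q < k`).  DICHOTOMY: if `g_R` is non-constant, `|Re x₁| ≥ c·e^{ℓ_n/k}`
against `Re x₀ = O(ℓ_n)` and `log‖x₁‖ = O(ℓ_n)` — THEOREM G; if `g_R` is constant,
`log‖y₁‖ = Re x₁ = a·log‖y₀‖ + O(1)` with `log‖y₀‖ = −(L/k)ℓ_n + O(1)` — THEOREM I (irrational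
ratio of growth exponents), exactly as in file LXXI.  Result:
**`unprojectedDense_branch_poleFibre_irrational'`** — `k ≥ 1`, `L ≠ 0`, `ψ(0) ≠ 0`, `Φ` analytic
with `Φ(0) = a ∈ ℝ ∖ ℚ`: dense, nothing else assumed.  With file LXXII (unit fibre values, every
`k`) this covers EVERY fibre value along EVERY equal-order place with a real irrational direction,
hence (file LXXV) every real irrational root of the top form, simple or not.  Decided instances of
an OPEN question (Mantova–Masser, PLMS 2024 §1 p. 5); EC(3,2) OPEN; NOT Schanuel's conjecture
(neither used nor implied); EAC ⇏ SC.
-/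

noncomputable section

open Filter Topology Metric Complex Polynomial
open Literature.NumberTheory.Transcendental Literature.ModelTheory.Zilber
open Literature.ModelTheory.ExponentialFields

set_option linter.dupNamespace false

namespace Summit.Schanuel.Schanuel.Theorems

/-- Degree of the subleading part `Q = (P − aX^k)∘(zX)` of a polynomial `P` of degree `k` with
`[X^k]P = a ≠ 0`: `deg Q ≤ k − 1`. [folklore] -/
theorem natDegree_subleading_comp_le {P : ℂ[X]} {k : ℕ} (hdeg : P.natDegree ≤ k) {a : ℂ}
    (hPk : P.coeff k = a) (ha : a ≠ 0) (z : ℂ) :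
    ((P - Polynomial.C a * X ^ k).comp (Polynomial.C z * X)).natDegree ≤ k - 1 := by
  have hPolk : P.natDegree = k :=
    le_antisymm hdeg (Polynomial.le_natDegree_of_ne_zero (by rw [hPk]; exact ha))
  have hlead : P.leadingCoeff = a := by rw [Polynomial.leadingCoeff, hPolk, hPk]
  have herase : P - Polynomial.C a * X ^ k = P.eraseLead := by
    rw [← hlead, ← hPolk, Polynomial.self_sub_C_mul_X_pow]
  rw [herase]
  refine (Polynomial.natDegree_comp_le).trans ?_
  have h1 : (Polynomial.C z * X : ℂ[X]).natDegree ≤ 1 :=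
    (Polynomial.natDegree_C_mul_le _ _).trans (by rw [Polynomial.natDegree_X])
  have h2 : P.eraseLead.natDegree ≤ k - 1 := by
    have := Polynomial.eraseLead_natDegree_le P
    rwa [hPolk] at this
  calc P.eraseLead.natDegree * (Polynomial.C z * X : ℂ[X]).natDegree ≤ (k - 1) * 1 :=
        Nat.mul_le_mul h2 h1
    _ = k - 1 := mul_one _

/-- **Pole / zero fibre values along an equal-order place with a real IRRATIONAL direction:
dense, for every ramification `k` and every Puiseux tail.**  A cylinder germ
`(s^{-k}, Φ(s)s^{-k}, ψ(s)s^L, e^{x₁})` (`k ≥ 1`, `L ≠ 0`, `ψ(0) ≠ 0`, `Φ` analytic at `0`,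
`Φ(0) = a ∈ ℝ ∖ ℚ`) in an irreducible closed `S` of dimension `≤ 2` has `I(S ∩ Γ_exp) = I(S)`
(subleading growth: THEOREM G; none: THEOREM I).
[cite: MantovaMasser2023, §1 Further remarks, p. 5 (the question, open in general)] (new) -/
theorem unprojectedDense_branch_poleFibre_irrational' {S : Set (Fin 2 ⊕ Fin 2 → ℂ)}
    (hS : IsIrreducibleClosed ℂ S) (hdim : zariskiDim ℂ S ≤ (2 : ℕ))
    {k : ℕ} (hk : 1 ≤ k) {L : ℤ} (hL : L ≠ 0) {ψ : ℂ → ℂ} (hψ : AnalyticAt ℂ ψ 0)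
    (hψ0 : ψ 0 ≠ 0) {Φ : ℂ → ℂ} (hΦ : AnalyticAt ℂ Φ 0) {a : ℝ} (ha : Irrational a)
    (hΦ0 : Φ 0 = a)
    (hgerm : ∀ᶠ s in 𝓝[≠] (0 : ℂ),
      (Sum.elim ![(s ^ k)⁻¹, Φ s * (s ^ k)⁻¹] ![ψ s * s ^ L, Complex.exp (Φ s * (s ^ k)⁻¹)] :
        Fin 2 ⊕ Fin 2 → ℂ) ∈ S) :
    UnprojectedDense S := by
  classical
  have hk0 : k ≠ 0 := by omega
  have hkR : (0 : ℝ) < k := by exact_mod_cast Nat.pos_of_ne_zero hk0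
  have ha0 : (a : ℂ) ≠ 0 := by exact_mod_cast ha.ne_zero
  obtain ⟨z, hz⟩ := IsAlgClosed.exists_pow_nat_eq (2 * Real.pi * I : ℂ) (by omega : 0 < k)
  have h2πI : (2 * Real.pi * I : ℂ) ≠ 0 := by simp [Real.pi_ne_zero, Complex.I_ne_zero]
  have hz0 : z ≠ 0 := by
    rintro rfl
    rw [zero_pow hk0] at hz
    exact h2πI hz.symm
  have hznorm : ‖z‖ ^ k = 2 * Real.pi := by
    rw [← norm_pow, hz, norm_mul, Complex.norm_I, mul_one, Complex.norm_mul, Complex.norm_real,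
      Complex.norm_ofNat, Real.norm_eq_abs, abs_of_pos Real.pi_pos]
  obtain ⟨N₀, u, s, w, W, hN₀, hu, hu0, hwW, hudef, hsu, hs0, hs, hexp⟩ :=
    exists_poleFibre_expPoints hk L hψ hψ0 hz
  -- Taylor split of `Φ` to order `k`
  obtain ⟨Pol, R, hPdeg, hPk, hRan, hsplit⟩ := exists_taylor_split_coeff hΦ k
  have hsW : Tendsto s atTop (𝓝[≠] (0 : ℂ)) :=
    tendsto_nhdsWithin_iff.2 ⟨hs, Eventually.of_forall hs0⟩
  obtain ⟨J₀, hJ₀⟩ := Filter.eventually_atTop.1 (hsW.eventually hgerm)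
  set n : ℕ → ℕ := fun m => N₀ + (J₀ + m) with hn
  have hn1 : ∀ m, (1 : ℝ) ≤ (n m : ℝ) := fun m => by
    simp only [hn]; exact_mod_cast (show 1 ≤ N₀ + (J₀ + m) by omega)
  set p : ℕ → Fin 2 ⊕ Fin 2 → ℂ := fun m =>
    Sum.elim ![(s (J₀ + m) ^ k)⁻¹, Φ (s (J₀ + m)) * (s (J₀ + m) ^ k)⁻¹]
      ![ψ (s (J₀ + m)) * s (J₀ + m) ^ L, Complex.exp (Φ (s (J₀ + m)) * (s (J₀ + m) ^ k)⁻¹)]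
    with hp
  have hpS : ∀ m, p m ∈ S := fun m => hJ₀ (J₀ + m) (Nat.le_add_right _ _)
  have hpΓ : ∀ m, p m ∈ expGraph ℂ 2 := by
    intro m
    rw [mem_expGraph_iff]
    intro i
    rw [Literature.ModelTheory.ExponentialFields.ExponentialRing.complex_exp_eq]
    fin_cases i
    · simp [hp, hexp (J₀ + m)]
    · simp [hp]
  -- labels `ℓ = log n → ∞`
  set ℓ : ℕ → ℝ := fun m => Real.log (n m : ℝ) with hℓ
  have hℓ0 : ∀ m, 0 ≤ ℓ m := fun m => Real.log_nonneg (hn1 m)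
  have hℓt : Tendsto ℓ atTop atTop := by
    rw [hℓ]
    refine Real.tendsto_log_atTop.comp (tendsto_natCast_atTop_atTop.comp ?_)
    exact (tendsto_add_atTop_nat (N₀ + J₀)).congr fun m => by simp only [hn]; omega
  have hst : Tendsto (fun m => s (J₀ + m)) atTop (𝓝 0) :=
    hs.comp ((tendsto_add_atTop_nat J₀).congr fun m => by ring)
  have hut : Tendsto (fun m => u (J₀ + m)) atTop (𝓝 1) :=
    hu.comp ((tendsto_add_atTop_nat J₀).congr fun m => by ring)
  -- `‖s‖ = ‖z⁻¹‖·e^{−ℓ/k}·‖u‖` and `s⁻¹ = z·e^{ℓ/k}·u⁻¹`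
  have hcast : ∀ m, (-(Real.log ((N₀ + (J₀ + m) : ℕ) : ℝ) : ℂ) / k) = -(((ℓ m / k : ℝ) : ℂ)) := by
    intro m
    simp only [hℓ, hn]
    push_cast
    ring
  have hns : ∀ m, ‖s (J₀ + m)‖ = ‖z⁻¹‖ * Real.exp (-(ℓ m) / k) * ‖u (J₀ + m)‖ := by
    intro m
    rw [hsu (J₀ + m), norm_mul, norm_mul, hcast m, ← Complex.ofReal_neg, ← Complex.ofReal_exp,
      Complex.norm_real, Real.norm_eq_abs, abs_of_pos (Real.exp_pos _), neg_div]
  have hsinv : ∀ m, (s (J₀ + m))⁻¹ = z * ((Real.exp (ℓ m / k) : ℝ) : ℂ) * (u (J₀ + m))⁻¹ := by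
    intro m
    rw [hsu (J₀ + m), mul_inv, mul_inv, inv_inv, hcast m, Complex.exp_neg, inv_inv,
      Complex.ofReal_exp]
  -- the two multiplicative coordinates
  have hy0 : ∀ m, p m (Sum.inr 0) = ψ (s (J₀ + m)) * s (J₀ + m) ^ L := fun m => by
    simp [hp]
  have hy1 : ∀ m, p m (Sum.inr 1) = Complex.exp (Φ (s (J₀ + m)) * (s (J₀ + m) ^ k)⁻¹) :=
    fun m => by simp [hp]
  have hx1 : ∀ m, p m (Sum.inl 1) = Φ (s (J₀ + m)) * (s (J₀ + m) ^ k)⁻¹ := fun m => by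
    simp [hp]
  have hψne : ∀ m, ψ (s (J₀ + m)) ≠ 0 := by
    intro m h0
    have := hexp (J₀ + m)
    rw [h0, zero_mul] at this
    exact Complex.exp_ne_zero _ this
  have hy0ne : ∀ m, p m (Sum.inr 0) ≠ 0 := fun m => by
    rw [hy0]
    exact mul_ne_zero (hψne m) (zpow_ne_zero _ (hs0 _))
  -- `log ‖y₀‖ = log ‖ψ(s)‖ + L·(log ‖z⁻¹‖ − ℓ/k + log ‖u‖)`
  have hlog0 : ∀ m, Real.log ‖p m (Sum.inr 0)‖ = Real.log ‖ψ (s (J₀ + m))‖ +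
      L * (Real.log ‖z⁻¹‖ + -(ℓ m) / k + Real.log ‖u (J₀ + m)‖) := by
    intro m
    have h1 : ‖ψ (s (J₀ + m))‖ ≠ 0 := norm_ne_zero_iff.2 (hψne m)
    have h2 : ‖z⁻¹‖ ≠ 0 := norm_ne_zero_iff.2 (inv_ne_zero hz0)
    have h3 : ‖u (J₀ + m)‖ ≠ 0 := norm_ne_zero_iff.2 (hu0 _)
    have h4 : Real.exp (-(ℓ m) / k) ≠ 0 := (Real.exp_pos _).ne'
    rw [hy0, norm_mul, norm_zpow, Real.log_mul h1 (zpow_ne_zero _ (norm_ne_zero_iff.2 (hs0 _))),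
      Real.log_zpow, hns m, Real.log_mul (mul_ne_zero h2 h4) h3, Real.log_mul h2 h4, Real.log_exp]
  -- `Re x₀ = log ‖y₀‖`, `Re x₁ = log ‖y₁‖`
  have hre0 : ∀ m, ((s (J₀ + m) ^ k)⁻¹).re = Real.log ‖p m (Sum.inr 0)‖ := by
    intro m
    rw [hy0, ← hexp (J₀ + m), Complex.norm_exp, Real.log_exp]
  have hre1 : ∀ m, Real.log ‖p m (Sum.inr 1)‖ = (p m (Sum.inl 1)).re := by
    intro m
    rw [hy1, hx1, Complex.norm_exp, Real.log_exp]
  -- the decomposition `x₁ = a·x₀ + Q(e^{ℓ/k}u⁻¹) + R(s)`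
  set Q : ℂ[X] := (Pol - Polynomial.C (Φ 0) * X ^ k).comp (Polynomial.C z * X) with hQ
  have hQeval : ∀ y : ℂ, Pol.eval (z * y) = Φ 0 * (z * y) ^ k + Q.eval y := by
    intro y
    simp only [hQ, Polynomial.eval_comp, Polynomial.eval_sub, Polynomial.eval_mul,
      Polynomial.eval_C, Polynomial.eval_X, Polynomial.eval_pow]
    ring
  have hQdeg : Q.natDegree ≤ k - 1 :=
    natDegree_subleading_comp_le hPdeg hPk (by rw [hΦ0]; exact ha0) z
  set E : ℕ → ℝ := fun m => Real.exp (ℓ m / k) with hE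
  have hE1 : ∀ m, 1 ≤ E m := fun m => Real.one_le_exp (div_nonneg (hℓ0 m) hkR.le)
  have hx1' : ∀ m, p m (Sum.inl 1) = (a : ℂ) * (s (J₀ + m) ^ k)⁻¹ +
      Q.eval (((E m : ℝ) : ℂ) * (u (J₀ + m))⁻¹) + R (s (J₀ + m)) := by
    intro m
    have h2 : Pol.eval (s (J₀ + m))⁻¹ = Φ 0 * ((s (J₀ + m))⁻¹) ^ k +
        Q.eval (((E m : ℝ) : ℂ) * (u (J₀ + m))⁻¹) := by
      have := hQeval (((E m : ℝ) : ℂ) * (u (J₀ + m))⁻¹)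
      rw [← mul_assoc, ← hsinv m] at this
      exact this
    rw [hx1 m, ← inv_pow, hsplit _ (hs0 _), h2, hΦ0]
  obtain ⟨gR, gI, hgR, -⟩ := exists_re_im_polynomials Q
  set D : ℕ → ℂ := fun m =>
    Q.eval (((E m : ℝ) : ℂ) * (u (J₀ + m))⁻¹) - Q.eval ((E m : ℝ) : ℂ) with hD
  have hre1' : ∀ m, (p m (Sum.inl 1)).re = a * Real.log ‖p m (Sum.inr 0)‖ +
      gR.eval (E m) + (D m).re + (R (s (J₀ + m))).re := by
    intro m
    rw [hx1' m, Complex.add_re, Complex.add_re, Complex.re_ofReal_mul, hre0 m, ← hgR]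
    simp only [hD, Complex.sub_re]
    ring
  -- `D → 0` (the unit factor is `1 + O(log n/n)`, `deg Q < k`)
  have hDt : Tendsto D atTop (𝓝 0) := by
    have hv2 : ∀ᶠ m in atTop, ‖(u (J₀ + m))⁻¹‖ ≤ 2 := by
      have h1 : Tendsto (fun m => (u (J₀ + m))⁻¹) atTop (𝓝 1) := by
        have := hut.inv₀ one_ne_zero
        rwa [inv_one] at this
      filter_upwards [Metric.tendsto_nhds.1 h1 1 one_pos] with m hm
      rw [dist_eq_norm] at hm
      have := norm_le_norm_add_norm_sub' (u (J₀ + m))⁻¹ 1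
      rw [norm_one] at this
      linarith
    have hrate : Tendsto (fun m => E m ^ (k - 1) * ‖(u (J₀ + m))⁻¹ - 1‖) atTop (𝓝 0) := by
      have h := (tendsto_exp_pow_mul_norm_inv_sub_one hk L hN₀ hwW hudef
        (d := k - 1) (by omega)).comp ((tendsto_add_atTop_nat J₀).congr fun m => add_comm m J₀)
      refine h.congr fun m => ?_
      simp only [Function.comp_apply, hE, hℓ, hn]
    exact tendsto_eval_mul_sub_eval Q hQdeg hE1 hv2 hrate
  -- bounded terms: `log ‖ψ(s_m)‖`, `log ‖u_m‖`, `Re D_m`, `Re R(s_m)`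
  have hψlog : ∀ᶠ m in atTop, |Real.log ‖ψ (s (J₀ + m))‖| ≤ |Real.log ‖ψ 0‖| + 1 := by
    have h1 : Tendsto (fun m => Real.log ‖ψ (s (J₀ + m))‖) atTop (𝓝 (Real.log ‖ψ 0‖)) :=
      ((Real.continuousAt_log (norm_ne_zero_iff.2 hψ0)).tendsto.comp
        ((continuous_norm.tendsto _).comp (hψ.continuousAt.tendsto.comp hst)))
    filter_upwards [Metric.tendsto_nhds.1 h1 1 one_pos] with m hm
    rw [Real.dist_eq] at hm
    have := abs_sub_abs_le_abs_sub (Real.log ‖ψ (s (J₀ + m))‖) (Real.log ‖ψ 0‖)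
    linarith
  have hulog : ∀ᶠ m in atTop, |Real.log ‖u (J₀ + m)‖| ≤ 1 := by
    have h1 : Tendsto (fun m => Real.log ‖u (J₀ + m)‖) atTop (𝓝 (Real.log ‖(1 : ℂ)‖)) :=
      ((Real.continuousAt_log (by simp)).tendsto.comp ((continuous_norm.tendsto _).comp hut))
    rw [norm_one, Real.log_one] at h1
    filter_upwards [Metric.tendsto_nhds.1 h1 1 one_pos] with m hm
    rw [Real.dist_eq, sub_zero] at hm
    exact hm.le
  have hDre : ∀ᶠ m in atTop, |(D m).re| ≤ 1 := by
    filter_upwards [Metric.tendsto_nhds.1 hDt 1 one_pos] with m hm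
    rw [dist_eq_norm, sub_zero] at hm
    exact ((Complex.abs_re_le_norm _).trans hm.le)
  have hRre : ∀ᶠ m in atTop, |(R (s (J₀ + m))).re| ≤ ‖R 0‖ + 1 := by
    have h1 : Tendsto (fun m => R (s (J₀ + m))) atTop (𝓝 (R 0)) :=
      hRan.continuousAt.tendsto.comp hst
    filter_upwards [Metric.tendsto_nhds.1 h1 1 one_pos] with m hm
    rw [dist_eq_norm] at hm
    refine (Complex.abs_re_le_norm _).trans ?_
    have := norm_le_norm_add_norm_sub' (R (s (J₀ + m))) (R 0)
    linarith
  -- `log ‖y₀‖ = dℓ + O(1)`, `d = −L/k`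
  set d : ℝ := -(L : ℝ) / k with hd
  have hd0 : d ≠ 0 := by
    rw [hd]
    exact div_ne_zero (neg_ne_zero.2 (Int.cast_ne_zero.2 hL)) hkR.ne'
  set E₀ : ℝ := |Real.log ‖ψ 0‖| + 1 + |(L : ℝ)| * (|Real.log ‖z⁻¹‖| + 1) with hE₀
  have hE₀0 : 0 ≤ E₀ := by positivity
  have hα' : ∀ᶠ m in atTop, |Real.log ‖p m (Sum.inr 0)‖ - d * ℓ m| ≤ E₀ := by
    filter_upwards [hψlog, hulog] with m hψm hum
    have e : Real.log ‖p m (Sum.inr 0)‖ - d * ℓ m =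
        Real.log ‖ψ (s (J₀ + m))‖ + (L : ℝ) * (Real.log ‖z⁻¹‖ + Real.log ‖u (J₀ + m)‖) := by
      rw [hlog0 m, hd]
      ring
    rw [e, hE₀]
    refine (abs_add_le _ _).trans (add_le_add hψm ?_)
    rw [abs_mul]
    exact mul_le_mul_of_nonneg_left ((abs_add_le _ _).trans (add_le_add le_rfl hum)) (abs_nonneg _)
  by_cases hgRdeg : gR.natDegree = 0
  · /- (i) NO SUBLEADING GROWTH: `Re x₁ = a·Re x₀ + O(1)`; THEOREM I -/
    set r₀ : ℝ := gR.coeff 0 with hr₀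
    have hgRev : ∀ x : ℝ, gR.eval x = r₀ := fun x => by
      rw [Polynomial.eq_C_of_natDegree_eq_zero hgRdeg, Polynomial.eval_C]
    set E₁ : ℝ := |a| * E₀ + |r₀| + 1 + (‖R 0‖ + 1) + E₀ with hE₁
    have hα : ∀ᶠ m in atTop, p m (Sum.inr 0) ≠ 0 ∧
        |Real.log ‖p m (Sum.inr 0)‖ - d * ℓ m| ≤ E₁ := by
      filter_upwards [hα'] with m hm
      refine ⟨hy0ne m, hm.trans ?_⟩
      have : 0 ≤ |a| * E₀ + |r₀| + 1 + (‖R 0‖ + 1) := by positivity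
      rw [hE₁]
      linarith
    have hβ : ∀ᶠ m in atTop, p m (Sum.inr 1) ≠ 0 ∧
        |Real.log ‖p m (Sum.inr 1)‖ - a * d * ℓ m| ≤ E₁ := by
      filter_upwards [hα', hDre, hRre] with m hm hDm hRm
      refine ⟨by rw [hy1]; exact Complex.exp_ne_zero _, ?_⟩
      have e : Real.log ‖p m (Sum.inr 1)‖ - a * d * ℓ m =
          a * (Real.log ‖p m (Sum.inr 0)‖ - d * ℓ m) + r₀ + (D m).re + (R (s (J₀ + m))).re := by
        rw [hre1 m, hre1' m, hgRev]
        ring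
      rw [e, hE₁]
      have h1 : |a * (Real.log ‖p m (Sum.inr 0)‖ - d * ℓ m)| ≤ |a| * E₀ := by
        rw [abs_mul]
        exact mul_le_mul_of_nonneg_left hm (abs_nonneg _)
      have h2 := abs_add_le (a * (Real.log ‖p m (Sum.inr 0)‖ - d * ℓ m) + r₀ + (D m).re)
        (R (s (J₀ + m))).re
      have h3 := abs_add_le (a * (Real.log ‖p m (Sum.inr 0)‖ - d * ℓ m) + r₀) (D m).re
      have h4 := abs_add_le (a * (Real.log ‖p m (Sum.inr 0)‖ - d * ℓ m)) r₀
      linarith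
    exact unprojectedDense_of_logGrowth_irrational hS hdim (Sum.inr 0) (Sum.inr 1) hpS hpΓ hℓt ha
      hd0 hα hβ
  · /- (ii) SUBLEADING GROWTH: `|Re x₁| ≥ c·e^{ℓ/k}`; THEOREM G -/
    have hg1 : 1 ≤ gR.natDegree := by omega
    obtain ⟨c, hc, hev⟩ := eventually_mul_le_abs_eval gR hg1
    have hEt : Tendsto E atTop atTop := by
      rw [hE]
      exact Real.tendsto_exp_atTop.comp (hℓt.atTop_div_const hkR)
    have hgrow : ∀ᶠ m in atTop, c * E m ≤ |gR.eval (E m)| := hEt.eventually hev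
    -- the small terms are `≤ (c/2)·e^{ℓ/k}` eventually
    have hsmall : ∀ᶠ m in atTop,
        |a| * (|d| * ℓ m + E₀) + 1 + (‖R 0‖ + 1) ≤ c / 2 * E m := by
      have ht := tendsto_mul_add_div_exp hℓt (κ := 1 / k) (by positivity) (|a| * |d|)
        (|a| * E₀ + 1 + (‖R 0‖ + 1))
      filter_upwards [Metric.tendsto_nhds.1 ht (c / 2) (by positivity)] with m hm
      rw [Real.dist_eq, sub_zero] at hm
      have hpos : 0 < Real.exp (1 / k * ℓ m) := Real.exp_pos _
      have h1 := (abs_lt.1 hm).2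
      rw [div_lt_iff₀ hpos] at h1
      have e1 : Real.exp (1 / k * ℓ m) = E m := by rw [hE]; congr 1; ring
      rw [e1] at h1
      have e2 : |a| * (|d| * ℓ m + E₀) + 1 + (‖R 0‖ + 1) =
          |a| * |d| * ℓ m + (|a| * E₀ + 1 + (‖R 0‖ + 1)) := by ring
      rw [e2]
      exact h1.le
    have hlog0abs : ∀ᶠ m in atTop, |Real.log ‖p m (Sum.inr 0)‖| ≤ |d| * ℓ m + E₀ := by
      filter_upwards [hα'] with m hm
      have h1 := abs_add_le (Real.log ‖p m (Sum.inr 0)‖ - d * ℓ m) (d * ℓ m)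
      rw [sub_add_cancel, abs_mul, abs_of_nonneg (hℓ0 m)] at h1
      linarith
    have hreal : ∀ᶠ m in atTop, c / 2 * Real.exp (1 / k * ℓ m) ≤ |(p m (Sum.inl 1)).re| := by
      filter_upwards [hgrow, hsmall, hlog0abs, hDre, hRre] with m hgm hsm hl0 hDm hRm
      have e1 : Real.exp (1 / k * ℓ m) = E m := by rw [hE]; congr 1; ring
      rw [e1, hre1' m]
      have h1 : |a * Real.log ‖p m (Sum.inr 0)‖| ≤ |a| * (|d| * ℓ m + E₀) := by
        rw [abs_mul]
        exact mul_le_mul_of_nonneg_left hl0 (abs_nonneg _)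
      -- `|A + g + D + R| ≥ |g| − |A| − |D| − |R|`
      have h2 := abs_sub_abs_le_abs_sub (gR.eval (E m))
        (-(a * Real.log ‖p m (Sum.inr 0)‖ + (D m).re + (R (s (J₀ + m))).re))
      have h3 : |-(a * Real.log ‖p m (Sum.inr 0)‖ + (D m).re + (R (s (J₀ + m))).re)| ≤
          |a| * (|d| * ℓ m + E₀) + 1 + (‖R 0‖ + 1) := by
        rw [abs_neg]
        have := abs_add_le (a * Real.log ‖p m (Sum.inr 0)‖ + (D m).re) (R (s (J₀ + m))).re
        have := abs_add_le (a * Real.log ‖p m (Sum.inr 0)‖) (D m).re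
        linarith
      have e2 : gR.eval (E m) - -(a * Real.log ‖p m (Sum.inr 0)‖ + (D m).re + (R (s (J₀ + m))).re)
          = a * Real.log ‖p m (Sum.inr 0)‖ + gR.eval (E m) + (D m).re + (R (s (J₀ + m))).re := by
        ring
      rw [e2] at h2
      linarith
    -- `‖x₁‖ ≤ e^{2ℓ}` eventually
    have hnorm : ∀ᶠ m in atTop, ‖p m (Sum.inl 1)‖ ≤ Real.exp (2 * ℓ m) := by
      have hΦb : ∀ᶠ m in atTop, ‖Φ (s (J₀ + m))‖ ≤ ‖(a : ℂ)‖ + 1 := by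
        have h1 : Tendsto (fun m => Φ (s (J₀ + m))) atTop (𝓝 (Φ 0)) :=
          hΦ.continuousAt.tendsto.comp hst
        filter_upwards [Metric.tendsto_nhds.1 h1 1 one_pos] with m hm
        rw [dist_eq_norm, hΦ0] at hm
        have := norm_le_norm_add_norm_sub' (Φ (s (J₀ + m))) (a : ℂ)
        linarith
      have hub : ∀ᶠ m in atTop, ‖(u (J₀ + m))⁻¹‖ ≤ 2 := by
        have h1 : Tendsto (fun m => (u (J₀ + m))⁻¹) atTop (𝓝 1) := by
          have := hut.inv₀ one_ne_zero
          rwa [inv_one] at this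
        filter_upwards [Metric.tendsto_nhds.1 h1 1 one_pos] with m hm
        rw [dist_eq_norm] at hm
        have := norm_le_norm_add_norm_sub' (u (J₀ + m))⁻¹ 1
        rw [norm_one] at this
        linarith
      have hbig : ∀ᶠ m in atTop, (‖(a : ℂ)‖ + 1) * (2 * Real.pi * 2 ^ k) ≤ Real.exp (ℓ m) :=
        (Real.tendsto_exp_atTop.comp hℓt).eventually (eventually_ge_atTop _)
      filter_upwards [hΦb, hub, hbig] with m hΦm hum hbm
      have hx0 : ‖(s (J₀ + m) ^ k)⁻¹‖ ≤ 2 * Real.pi * 2 ^ k * Real.exp (ℓ m) := by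
        rw [← inv_pow, hsinv m, mul_pow, mul_pow, norm_mul, norm_mul, norm_pow, norm_pow, norm_pow,
          hznorm, Complex.norm_real, Real.norm_eq_abs, abs_of_pos (Real.exp_pos _),
          ← Real.exp_nat_mul, show (k : ℝ) * (ℓ m / k) = ℓ m by field_simp]
        have h1 : ‖(u (J₀ + m))⁻¹‖ ^ k ≤ 2 ^ k := pow_le_pow_left₀ (norm_nonneg _) hum k
        have h2 : 0 ≤ 2 * Real.pi * Real.exp (ℓ m) := by positivity
        nlinarith
      rw [hx1 m, norm_mul]
      have h3 : (2 : ℝ) * ℓ m = ℓ m + ℓ m := by ring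
      rw [h3, Real.exp_add]
      calc ‖Φ (s (J₀ + m))‖ * ‖(s (J₀ + m) ^ k)⁻¹‖
          ≤ (‖(a : ℂ)‖ + 1) * (2 * Real.pi * 2 ^ k * Real.exp (ℓ m)) :=
            mul_le_mul hΦm hx0 (norm_nonneg _) (by positivity)
        _ = (‖(a : ℂ)‖ + 1) * (2 * Real.pi * 2 ^ k) * Real.exp (ℓ m) := by ring
        _ ≤ Real.exp (ℓ m) * Real.exp (ℓ m) :=
            mul_le_mul_of_nonneg_right hbm (Real.exp_pos _).le
    have hgr := tendsto_growth_ratio_of_exp_bounds (α := 1 / k) (β := 2) (c := c / 2)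
      (by positivity) (by norm_num) (by positivity) hℓt hreal hnorm
    exact unprojectedDense_of_growth hS hdim 1 hpS hpΓ hgr

/-- **`k`-agnostic corollary in the shape of file LXXI** (the Lipschitz hypothesis dropped).
[cite: MantovaMasser2023, §1 Further remarks, p. 5 (the question, open in general)] (new) -/
theorem unprojectedDense_branch_fibre_irrational {S : Set (Fin 2 ⊕ Fin 2 → ℂ)}
    (hS : IsIrreducibleClosed ℂ S) (hdim : zariskiDim ℂ S ≤ (2 : ℕ))
    {k : ℕ} (hk : 1 ≤ k) (L : ℤ) (hL : L ≠ 0) {ψ : ℂ → ℂ} (hψ : AnalyticAt ℂ ψ 0)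
    (hψ0 : ψ 0 ≠ 0) {Φ : ℂ → ℂ} (hΦ : AnalyticAt ℂ Φ 0) {a : ℝ} (ha : Irrational a)
    (hΦ0 : Φ 0 = a)
    (hgerm : ∀ᶠ s in 𝓝[≠] (0 : ℂ),
      (Sum.elim ![(s ^ k)⁻¹, Φ s * (s ^ k)⁻¹] ![ψ s * s ^ L, Complex.exp (Φ s * (s ^ k)⁻¹)] :
        Fin 2 ⊕ Fin 2 → ℂ) ∈ S) :
    UnprojectedDense S :=
  unprojectedDense_branch_poleFibre_irrational' hS hdim hk hL hψ hψ0 hΦ ha hΦ0 hgerm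

end Summit.Schanuel.Schanuel.Theorems

end
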